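import Summits.NavierStokesRegularity.FluidComputer.RowCircuitSection
import Summits.NavierStokesRegularity.FluidComputer.RowSectionSpan
import HarnessLib

/-!
# `RowCircuitSectionSpan`: the induction read-out of the certified circuit over the THREE-row
# window `1063 | 1064 | 1065` (`pub-fluidc-bp3/R1-DESIGN.md` §15; twin
# `code/thgate/g26/section26.py --nwin 3`)

HONEST FRAMING (cell `pub-fluidc`, blueprint seat bp3, gen 26): low prior, high value-of-information
experiment on Tao's machine paradigm; NOT a claim that NS blows up. No fluid mechanics and no new
mathematics: the span certificate `RowSectionSpan.sectionOKspan` decided on the chain of record by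
`native_decide`, the three-row clock re-cut, and the read-out theorem re-derived through
`section_sound_span` — the in-tree instance of the generic span read-out that the twin uses, at
wider boxes and under class forcing, for the per-class re-closure of the induction box (R1-DESIGN
§15).

WHAT. **`span_cert : sectionOKspan (fun i => row (1063 + i)) 2 secCert = true`** — opening the
read-out window one row earlier than `RowCircuitSection.section_cert` (S1 on row 1063, S2 on row
1065, S3 on all three rows; at base the S1 margin `−π̂/ρĒ_{a₂}` at the window start goes from 1.47
to 6.99 while the box image is unchanged, twin numbers). **`windowQ3`**: the three window rows are
short and slow, `Σ (H + 3ρH) ≤ 19/10000`. **`circuit_section_span_from`**: the conclusion of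
`RowCircuitSection.circuit_section_from` VERBATIM (crossing at a physical time `τ`, `|τ − 19/20| ≤
3/500`, positive carrier, level in `[0.9673, 0.9718]`, read-out in `B′`), obtained from the
three-row certificate: `1/600 + 1/700 + 1/1000 + 19/10000 ≤ 3/500`.

[cite: Tao2016AveragedNS, §5.5 Thm 5.3 (5.5)]
-/

namespace Summit.NavierStokesRegularity.FluidComputer

open Literature.Analysis.FluidPDE.FluidComputer

namespace RowChain

open RowCheck RowCheck.RowData RowRun ChainField Set

set_option maxHeartbeats 10000000 in
/-- **The span read-out certificate holds on the window rows `1063 | 1064 | 1065` of the chain of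
record** (box, slope, level range and `M` of `secCert`). [folklore] -/
theorem span_cert : sectionOKspan (fun i => row (1063 + i)) 2 secCert = true := by
  native_decide

/-- The three window rows are short and slow: `Σ_{k=1063}^{1065} (H_k + 3(ρH)_k) ≤ 19/10000`.
[folklore] -/
theorem windowQ3 :
    (row 1063).Hq + (row 1064).Hq + (row 1065).Hq +
      3 * (((row 1063).ph'.rho : ℚ) / 2 ^ (row 1063).P * (row 1063).Hq) +
      3 * (((row 1064).ph'.rho : ℚ) / 2 ^ (row 1064).P * (row 1064).Hq) +
      3 * (((row 1065).ph'.rho : ℚ) / 2 ^ (row 1065).P * (row 1065).Hq) ≤ 19 / 10000 := by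
  native_decide

/-- **The exact circuit read out at its own section crossing, through the three-row window.** Same
conclusion as `circuit_section_from`: from any admissible start the circuit crosses `v_{b₂} = ρ
v_{a₂}` at a physical time `τ`, `|τ − 19/20| ≤ 3/500`, with positive carrier, level `v_{b₂}/X0_{b₁}
∈ [0.9673, 0.9718]` and the three read-out ratios in the induction box `B′`. [folklore] -/
theorem circuit_section_span_from (q₀ : Fin 9 → ℝ) (hlock : q₀ (row 0).p = X0 (row 0).p)
    (hbox : ∀ i, |z0 q₀ i| ≤ (row 0).ubR 0 i) :
    ∃ y : ℝ → Fin 9 → ℝ, y 0 = q₀ ∧ (∀ σ, HasDerivAt y (F gK ΛK (y σ)) σ) ∧ ∃ τ : ℝ,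
      |τ - 19 / 20| ≤ 3 / 500 ∧
      y τ 5 = (secCert.rho : ℝ) * y τ 4 ∧ 0 < y τ 4 ∧
      ((secCert.levLo : ℝ) ≤ y τ 5 / secCert.bmid ∧ y τ 5 / secCert.bmid ≤ secCert.levHi) ∧
      ∀ j : Fin 3, |(secCert.bmid : ℝ) * y τ (rdIdx j) / y τ 5 - secCert.ctr j| ≤
        secCert.wid j := by
  obtain ⟨y, hy0, hsol⟩ := CircuitFlow.circuit_solution gK ΛK q₀
  have hyc : Continuous y := continuous_iff_continuousAt.2 fun σ => (hsol σ).continuousAt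
  have hwin : ∀ (k k' : ℕ) (a : Fin 9), |(0 : ℝ → Fin 9 → ℝ) 0 a| ≤
      ((max ((row k).DEL a) ((row k').DEL a) : ℤ) : ℝ) / 2 ^ (row k').P :=
    fun k k' a => by
    rw [Pi.zero_apply, Pi.zero_apply, abs_zero]
    exact div_nonneg (by exact_mod_cast (DEL_nonneg_row k a).trans (le_max_left _ _))
      (by positivity)
  obtain ⟨sA, sdA, sB, sdB, sD, sdD, hs0, hmem, ⟨S1⟩, ⟨S2⟩⟩ := chain_members Tc Tc_succ (y := y)
    (δF := 0) (D := univ) isOpen_univ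
    (fun σ _ a => by simpa using (hasDerivAt_pi.1 (hsol σ)) a)
    (fun k _ => by
      have hc : Continuous fun σ => F gK ΛK (y σ) (row k).p :=
        (continuous_apply (row k).p).comp ((continuous_F gK ΛK).comp hyc)
      simpa using hc)
    (fun k _ σ _ t _ _ a => by simpa using δR_nonneg_row k a)
    (fun K _ _ => subset_univ _)
    (fun σ _ _ => ⟨subset_univ _, fun ξ _ a => hwin 656 657 a⟩)
    (fun σ _ _ => ⟨subset_univ _, fun ξ _ a => hwin 986 987 a⟩)
    (σ₀ := 0) (mem_univ _) (by rw [hy0, hlock]; rfl)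
    (fun i => by
      rw [z_start_eq_z0 (Tc 0) y 0 univ (fun _ => 0) (fun _ => 0) rfl hy0]
      exact hbox i)
  have hu0A : ∀ i, |(toModel (canon (framesOK_row 0)) (G 0) (Tc 0) ⟨y, 0, univ, sA, sdA⟩).z
      (Tc 0) i| ≤ (row 0).ubR 0 i := fun i => by
    rw [z_start_eq_z0 (Tc 0) y 0 univ sA sdA hs0 hy0]
    exact hbox i
  have h := segAD Tc Tc_succ ⟨y, 0, univ, sA, sdA⟩ ⟨y, 0, univ, sB, sdB⟩ ⟨y, 0, univ, sD, sdD⟩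
    (fun k hk => (hmem k hk).some) hu0A S1 S2
  -- the chain's clock up to the end of the last row
  have hrow : ∀ k < 1066, |(mOf ⟨y, 0, univ, sA, sdA⟩ ⟨y, 0, univ, sB, sdB⟩ ⟨y, 0, univ, sD, sdD⟩
      k).s (Tc (k + 1)) - (mOf ⟨y, 0, univ, sA, sdA⟩ ⟨y, 0, univ, sB, sdB⟩ ⟨y, 0, univ, sD, sdD⟩
      k).s (Tc k) - (row k).Hq| ≤ (row k).rhoR * (row k).Hq := by
    intro k hk
    have hH : Tc (k + 1) - Tc k = (row k).Hq := by rw [Tc_succ k]; ring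
    have hle : Tc k ≤ Tc (k + 1) := by
      have := Hq_pos ((runOK_iff _).mp (runOK_row k)).1
      linarith
    have h1 := row_time (hmem k hk).some hle (h k hk).2.2.2
    change |(mOf _ _ _ k).s (Tc (k + 1)) - (mOf _ _ _ k).s (Tc k) - (Tc (k + 1) - Tc k)| ≤
      (row k).rhoR * (Tc (k + 1) - Tc k) at h1
    rw [hH] at h1
    exact h1
  have hclock := chain_time Tc (fun k => ((row k).Hq : ℝ)) (fun k => (row k).rhoR) Tc_succ sA sB
    sD hs0 (fun k hk => by have := hrow k (by omega); rwa [mOf_A hk] at this)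
    (fun k hk hk' => by have := hrow k (by omega); rwa [mOf_B hk hk'] at this)
    (fun k hk hk' => by have := hrow k hk'; rwa [mOf_D hk] at this) S1.hσ S2.hσ
  rw [Tc_zero] at hclock
  -- the member on the window rows (segment D): continuity, tubes, per-row time
  set v : ℝ → Fin 9 → ℝ := fun t => y (sD t) with hv
  have hcont : ∀ k, 987 ≤ k → k < 1066 → ContinuousOn v (Icc (Tc k) (Tc (k + 1))) := by
    intro k hk1 hk2
    have hm := (hmem k hk2).some
    rw [mOf_D hk1] at hm
    have hsc := hm.hsc
    change ContinuousOn sD (Icc (Tc k) (Tc (k + 1))) at hsc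
    exact hyc.comp_continuousOn hsc
  have htube : ∀ k, 987 ≤ k → k < 1066 → ∀ t ∈ Icc (Tc k) (Tc (k + 1)), ∀ a,
      |v t a - xh (row k).CQ (t - Tc k) a| ≤ (row k).EbarR a := by
    intro k hk1 hk2 t ht a
    have h1 := (h k hk2).2.1 t ht a
    rw [mOf_D hk1] at h1
    exact h1
  have htime : ∀ k, 987 ≤ k → k < 1066 → ∀ t ∈ Icc (Tc k) (Tc (k + 1)),
      |sD t - sD (Tc k) - (t - Tc k)| ≤ (row k).rhoR * (row k).Hq := by
    intro k hk1 hk2 t ht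
    have hm := (hmem k hk2).some
    have hrate := (h k hk2).2.2.2
    rw [mOf_D hk1] at hm hrate
    have h1 := row_time_at hm hrate (t := t) ht
    change |sD t - sD (Tc k) - (t - Tc k)| ≤ (row k).rhoR * (t - Tc k) at h1
    have hρ : 0 ≤ (row k).rhoR := by
      have := hrate (Tc k) ⟨le_rfl, by
        have := Hq_pos ((runOK_iff _).mp (runOK_row k)).1
        rw [Tc_succ k]; linarith⟩
      exact (abs_nonneg _).trans this
    have hH : t - Tc k ≤ (row k).Hq := by rw [Tc_succ k] at ht; linarith [ht.2]
    exact h1.trans (mul_le_mul_of_nonneg_left hH hρ)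
  -- the section read-out over the three-row window
  have hT : ∀ i ≤ 2, Tc (1063 + (i + 1)) = Tc (1063 + i) + (row (1063 + i)).Hq := fun i _ => by
    rw [show 1063 + (i + 1) = (1063 + i) + 1 by ring]; exact Tc_succ (1063 + i)
  obtain ⟨t, ht, hsec, hpos, hlev, hrat⟩ := section_sound_span span_cert (v := v)
    (T := fun i => Tc (1063 + i)) hT
    (fun i hi => hcont (1063 + i) (by omega) (by omega))
    (fun i hi => htube (1063 + i) (by omega) (by omega))
  refine ⟨y, hy0, hsol, sD t, ?_, hsec, hpos, hlev, hrat⟩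
  -- the clock at the crossing
  obtain ⟨hS, hO, h19⟩ := time_budgetQ
  have hS' : ((∑ k ∈ Finset.range 1066, ((row k).ph'.rho : ℚ) / 2 ^ (row k).P * (row k).Hq : ℚ)
      : ℝ) ≤ ((1 / 600 : ℚ) : ℝ) := by exact_mod_cast hS
  have hO' : (((cert656.Ds : ℚ) / 2 ^ (row 657).P + (cert986.Ds : ℚ) / 2 ^ (row 987).P : ℚ) : ℝ)
      ≤ ((1 / 700 : ℚ) : ℝ) := by exact_mod_cast hO
  have h19' : ((|∑ k ∈ Finset.range 1066, (row k).Hq - 19 / 20| : ℚ) : ℝ) ≤ ((1 / 1000 : ℚ) : ℝ) :=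
    by exact_mod_cast h19
  have hw' := windowQ3
  have hw : (((row 1063).Hq + (row 1064).Hq + (row 1065).Hq +
      3 * (((row 1063).ph'.rho : ℚ) / 2 ^ (row 1063).P * (row 1063).Hq) +
      3 * (((row 1064).ph'.rho : ℚ) / 2 ^ (row 1064).P * (row 1064).Hq) +
      3 * (((row 1065).ph'.rho : ℚ) / 2 ^ (row 1065).P * (row 1065).Hq) : ℚ) : ℝ) ≤
      ((19 / 10000 : ℚ) : ℝ) := by exact_mod_cast hw'
  push_cast at hS' hO' h19' hw
  have hsum : ∑ k ∈ Finset.range 1066, (row k).rhoR * (row k).Hq =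
      ∑ k ∈ Finset.range 1066, ((row k).ph'.rho : ℝ) / 2 ^ (row k).P * (row k).Hq := rfl
  have hTc : Tc 1066 = ∑ k ∈ Finset.range 1066, ((row k).Hq : ℝ) := rfl
  have hρ3 : (row 1063).rhoR = ((row 1063).ph'.rho : ℝ) / 2 ^ (row 1063).P := rfl
  have hρ4 : (row 1064).rhoR = ((row 1064).ph'.rho : ℝ) / 2 ^ (row 1064).P := rfl
  have hρ5 : (row 1065).rhoR = ((row 1065).ph'.rho : ℝ) / 2 ^ (row 1065).P := rfl
  have hT4 : Tc 1064 = Tc 1063 + (row 1063).Hq := Tc_succ 1063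
  have hT5 : Tc 1065 = Tc 1064 + (row 1064).Hq := Tc_succ 1064
  have hT6 : Tc 1066 = Tc 1065 + (row 1065).Hq := Tc_succ 1065
  have hH3 : (0 : ℝ) < (row 1063).Hq := Hq_pos ((runOK_iff _).mp (runOK_row 1063)).1
  have hH4 : (0 : ℝ) < (row 1064).Hq := Hq_pos ((runOK_iff _).mp (runOK_row 1064)).1
  have hH5 : (0 : ℝ) < (row 1065).Hq := Hq_pos ((runOK_iff _).mp (runOK_row 1065)).1
  -- |sD(Tc 1066) − Tc 1066| ≤ S + O
  have hend : |sD (Tc 1066) - Tc 1066| ≤ 1 / 600 + 1 / 700 := by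
    have : |sD (Tc 1066) - 0 - (Tc 1066 - 0)| ≤ _ := hclock
    rw [sub_zero, sub_zero] at this
    rw [hsum] at this
    linarith
  -- rows 1065, 1064, 1063 full
  have h65 := htime 1065 (by norm_num) (by norm_num) (Tc 1066)
    ⟨by rw [hT6]; linarith, by change Tc 1066 ≤ Tc 1066; exact le_rfl⟩
  have h64 := htime 1064 (by norm_num) (by norm_num) (Tc 1065)
    ⟨by rw [hT5]; linarith, by change Tc 1065 ≤ Tc 1065; exact le_rfl⟩
  have h63 := htime 1063 (by norm_num) (by norm_num) (Tc 1064)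
    ⟨by rw [hT4]; linarith, by change Tc 1064 ≤ Tc 1064; exact le_rfl⟩
  have hρH3 : 0 ≤ (row 1063).rhoR * (row 1063).Hq := by
    have := htime 1063 (by norm_num) (by norm_num) (Tc 1063) ⟨le_rfl, by rw [hT4]; linarith⟩
    exact (abs_nonneg _).trans this
  have hρH4 : 0 ≤ (row 1064).rhoR * (row 1064).Hq := by
    have := htime 1064 (by norm_num) (by norm_num) (Tc 1064) ⟨le_rfl, by rw [hT5]; linarith⟩
    exact (abs_nonneg _).trans this
  have hρH5 : 0 ≤ (row 1065).rhoR * (row 1065).Hq := by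
    have := htime 1065 (by norm_num) (by norm_num) (Tc 1065) ⟨le_rfl, by rw [hT6]; linarith⟩
    exact (abs_nonneg _).trans this
  rw [hρ3] at h63 hρH3
  rw [hρ4] at h64 hρH4
  rw [hρ5] at h65 hρH5
  have ht1 : Tc 1063 ≤ t := ht.1
  have ht2' : t ≤ Tc (1065 + 1) := by have := ht.2; norm_num at this ⊢; exact this
  have ht2 : t ≤ Tc 1065 + (row 1065).Hq := by rw [← Tc_succ 1065]; exact ht2'
  have e1 := abs_le.mp hend
  have e2 := abs_le.mp h65
  have e3 := abs_le.mp h64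
  have e6 := abs_le.mp h63
  have e5 := abs_le.mp h19'
  rw [← hTc] at e5
  by_cases htk : t ≤ Tc 1064
  · -- crossing in row 1063
    have hpart := htime 1063 (by norm_num) (by norm_num) t ⟨ht1, htk⟩
    rw [hρ3] at hpart
    have e4 := abs_le.mp hpart
    rw [abs_le]; constructor <;> linarith
  · by_cases htk' : t ≤ Tc 1065
    · -- crossing in row 1064
      have hlt : Tc 1064 < t := lt_of_not_ge htk
      have hpart := htime 1064 (by norm_num) (by norm_num) t ⟨hlt.le, htk'⟩
      rw [hρ4] at hpart
      have e4 := abs_le.mp hpart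
      rw [abs_le]; constructor <;> linarith
    · -- crossing in row 1065
      have hlt : Tc 1065 < t := lt_of_not_ge htk'
      have hpart := htime 1065 (by norm_num) (by norm_num) t ⟨hlt.le, ht2'⟩
      rw [hρ5] at hpart
      have e4 := abs_le.mp hpart
      rw [abs_le]; constructor <;> linarith

end RowChain

end Summit.NavierStokesRegularity.FluidComputer
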